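/-
Copyright (c) 2026 the pub-hodgecm-mathlib formalisation cell (harness21).  Prover seat hodgecm-mathlib-A-p06 (g36), L2 organ (IMG) «IMAGE LINE ENGINE», the `himg`
engine's generic glue (LA2-plan (g2) STATUS #5 2026-09-02T09:30:06Z «(IMG-T)(c2)(d) + `himg` engine — A-p06»); 2026-09-02.
-/
import Literature.AlgebraicGeometry.GroupSchemes.AdmissibleIdealClosureSubscheme
import HarnessLib

/-!
# THE CLOSURE SUBSCHEME `V(J^sat) ↪ 𝒢` OF A HOPF IDEAL OF THE GENERIC FIBRE — IMAGE EDITION: the two REVERSE factorisations and the IMAGE heads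
# ([EGAIV2] Prop. 2.8.5; [Tate1997FiniteFlatGroupSchemes] (3.7))

Topic `Literature/AlgebraicGeometry/GroupSchemes`; namespace `Literature.AlgebraicGeometry.GroupSchemes.AffineGroupScheme` (continues ★
`AdmissibleIdealClosureSubscheme`).  THEOREMS ONLY (no definition, no instance, no notation, no named fact, no `sorry`).  Cell `hodgecm-mathlib` (D-0151),
programme P6 «MOD» (crux hLiu418 = stmt-HodgeConjecture-24832, `--supports`, count-neutral): line L2, organ (IMG) «IMAGE LINE ENGINE», the glue between the
Hopf-IDEAL currency of the L2 leaflet (`spGeoOf := spI …`) and the SUB-OBJECT currency of the image row (IMG-gen) of ★ `RoofLegsSpecialFibreKernelRowsImage` («a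
factorisation of the leg through flat model subschemes upstairs gives one downstairs»).  ★ `AdmissibleIdealClosureSubscheme` §3 proved, for a Hopf ideal `J` of
the generic fibre `𝒢_K` and its closure `𝒦 = V(J^sat) ↪ 𝒢`, the two factorisations a KILL statement needs: `𝒦_K → V(J)` over `𝒢_K` and `V(spI J) → 𝒦_κ` over `𝒢_κ`.
An IMAGE statement («`V(J)` is carried into `V(J″)`») has a source AND a target, so it needs the two REVERSE factorisations as well; both hold because the
ideals are EQUAL (★ §2: the ideal of `𝒦_K ↪ 𝒢_K` is `J`, the ideal of `𝒦_κ ↪ 𝒢_κ` is `spI J` on the nose), read through the other points criterion.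
HC_CM is proved only modulo the printed citations (2 remaining named inputs hLiu418 24832, h413 24833) until rung 0 closes; this file is generic and changes no count.

THE MATHEMATICS ([EGAIV2] Prop. 2.8.5: the schematic closure `𝒦` of a closed subscheme `Z` of the generic fibre of a flat `R`-scheme has generic fibre `Z`;
[Tate1997FiniteFlatGroupSchemes] (3.7); [GortzWedhorn2023] (27.1.1), §(27.2): closed subschemes of affine schemes ↔ ideals, points criterion).  `R` a Bézout domain
with fraction field `K`, `κ` an `R`-field, `𝒢` an affine `R`-group scheme, `J ⊂ Γ(𝒢_K)` a Hopf ideal, `J^sat = e_K(J) ∩ Γ(𝒢)`, `𝒦 = V(J^sat)`.  (§1) Since the ideal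
of `𝒦_K ↪ 𝒢_K` is `J` (★ `ker_comap_pullback_map_quotIncl_sat_eq`), the closed immersion `𝒦_K ↪ 𝒢_K` receives `V(J)` (★ `exists_comp_eq_of_le_ker`):
**`V(J) → 𝒦_K` over `𝒢_K`**; since the ideal of `𝒦_κ ↪ 𝒢_κ` is `spI J` (★ `ker_comap_pullback_map_quotIncl_sat_eq_spI`), the affine `𝒦_κ` factors through
`V(spI J)` (★ `exists_comp_quotIncl_eq_of_affine`): **`𝒦_κ → V(spI J)` over `𝒢_κ`**.  So `𝒦_K ≅ V(J)` over `𝒢_K` and `𝒦_κ ≅ V(spI J)` over `𝒢_κ` (both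
directions now available).  (§2) IMAGE HEADS, for two affine `R`-group schemes `𝒢`, `𝒢″` with Hopf ideals `J ⊂ Γ(𝒢_K)`, `J″ ⊂ Γ(𝒢″_K)` and ARBITRARY morphisms
`f : 𝒢_K → X ← 𝒢″_K : f″` (resp. `f̄ : 𝒢_κ → X̄ ← 𝒢″_κ : f̄″`): **(IMG-in)** if `quotIncl J ≫ f` factors through `quotIncl J″ ≫ f″` then `𝒦_K ↪ 𝒢_K ≫ f` factors
through `𝒵_K ↪ 𝒢″_K ≫ f″` (`𝒵 = V(J″^sat)`; compose `𝒦_K → V(J) → V(J″) → 𝒵_K`) — the conversion INTO the generic hypothesis of (IMG-gen); **(IMG-out)** if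
`𝒦_κ ↪ 𝒢_κ ≫ f̄` factors through `𝒵_κ ↪ 𝒢″_κ ≫ f̄″` then `quotIncl (spI J) ≫ f̄` factors through `quotIncl (spI J″) ≫ f̄″` (compose
`V(spI J) → 𝒦_κ → 𝒵_κ → V(spI J″)`) — the conversion OUT OF the special conclusion of (IMG-gen), into the currency of the L2 leaflet's `spGeoOf` ∕ `himg`.

* §1 **`exists_comp_pullback_map_quotIncl_sat_eq_quotIncl`** (`V(J) → 𝒦_K` over `𝒢_K`), **`exists_comp_quotIncl_spI_eq_pullback_map_quotIncl_sat`**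
  (`𝒦_κ → V(spI J)` over `𝒢_κ`);
* §2 HEADS **`exists_comp_pullback_map_quotIncl_sat_of_comp_quotIncl`** (IMG-in), **`exists_comp_quotIncl_spI_of_comp_pullback_map`** (IMG-out).

## References
* [EGAIV2] A. Grothendieck, J. Dieudonné, *ÉGA* IV₂, Publ. Math. IHÉS 24 (1965), Prop. 2.8.5.
* [Tate1997FiniteFlatGroupSchemes] J. Tate, *Finite flat group schemes* (1997), (3.7).
* [GortzWedhorn2023] U. Görtz, T. Wedhorn, *Algebraic Geometry II* (2023), (27.1.1), §(27.2) (27.2.1) (pp. 606–607).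
* [Waterhouse1979] W. C. Waterhouse, *Introduction to Affine Group Schemes*, GTM 66 (1979), §2.1 (p. 14).
-/

set_option autoImplicit false

set_option backward.isDefEq.respectTransparency false

universe u

open CategoryTheory CategoryTheory.Limits AlgebraicGeometry MonoidalCategory CartesianMonoidalCategory TensorProduct
open Algebra.TensorProduct (includeRight)

noncomputable section

namespace Literature.AlgebraicGeometry.GroupSchemes

namespace AffineGroupScheme

open scoped MonObj CategoryTheory.Obj

open Literature.AlgebraicGeometry.Motives

variable {R : Type u} [CommRing R] (K κ : Type u) [Field K] [Algebra R K] [Field κ] [Algebra R κ]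
  (G : SchemeOver R) [GrpObj G] [IsAffine G.left]
  [IsAffine ((Over.pullback (Spec.map (CommRingCat.ofHom (algebraMap R K)))).obj G).left]
  [IsAffine ((Over.pullback (Spec.map (CommRingCat.ofHom (algebraMap R κ)))).obj G).left]
  (J : Ideal (Alg ((Over.pullback (Spec.map (CommRingCat.ofHom (algebraMap R K)))).obj G)))

/-! ## §1 The two REVERSE factorisations: `V(J) → 𝒦_K` over `𝒢_K` and `𝒦_κ → V(spI J)` over `𝒢_κ` -/

omit [IsAffine ((Over.pullback (Spec.map (CommRingCat.ofHom (algebraMap R κ)))).obj G).left] in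
/-- **`V(J) ↪ 𝒢_K` FACTORS THROUGH `𝒦_K`** (points criterion ★ `exists_comp_eq_of_le_ker` for the closed immersion `𝒦_K ↪ 𝒢_K`, whose ideal is `J` by ★
`ker_comap_pullback_map_quotIncl_sat_eq`): the generic fibre of the closure `V(J^sat)` is all of `V(J)`. [cite: EGAIV2, Prop. 2.8.5]
[cite: GortzWedhorn2023, (27.1.1) and §(27.2) (p. 607)] -/
theorem exists_comp_pullback_map_quotIncl_sat_eq_quotIncl [IsFractionRing R K] [IsBezout R] [IsDomain R] (hJ : J.IsHopfIdeal K) :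
    ∃ m : Motives.specOver K (Alg ((Over.pullback (Spec.map (CommRingCat.ofHom (algebraMap R K)))).obj G) ⧸ J) ⟶
        (Over.pullback (Spec.map (CommRingCat.ofHom (algebraMap R K)))).obj
          (Motives.specOver R (Alg G ⧸ (J.map (algBaseChangeEquiv K G)).comap (includeRight : Alg G →ₐ[R] K ⊗[R] Alg G))),
      m ≫ (Over.pullback (Spec.map (CommRingCat.ofHom (algebraMap R K)))).map
          (quotIncl G ((J.map (algBaseChangeEquiv K G)).comap (includeRight : Alg G →ₐ[R] K ⊗[R] Alg G))) =
        quotIncl _ J := by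
  haveI : IsAffine (Motives.specOver R (Alg G ⧸ (J.map (algBaseChangeEquiv K G)).comap (includeRight : Alg G →ₐ[R] K ⊗[R] Alg G))).left :=
    inferInstanceAs (IsAffine (Spec _))
  haveI : IsAffine ((Over.pullback (Spec.map (CommRingCat.ofHom (algebraMap R K)))).obj
      (Motives.specOver R (Alg G ⧸ (J.map (algBaseChangeEquiv K G)).comap (includeRight : Alg G →ₐ[R] K ⊗[R] Alg G)))).left :=
    inferInstanceAs (IsAffine (pullback _ _))
  haveI : IsClosedImmersion (quotIncl G ((J.map (algBaseChangeEquiv K G)).comap (includeRight : Alg G →ₐ[R] K ⊗[R] Alg G))).left :=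
    isClosedImmersion_quotIncl_left G _
  haveI : IsClosedImmersion ((Over.pullback (Spec.map (CommRingCat.ofHom (algebraMap R K)))).map
      (quotIncl G ((J.map (algBaseChangeEquiv K G)).comap (includeRight : Alg G →ₐ[R] K ⊗[R] Alg G)))).left :=
    of_pullback_map_left _ (P := @IsClosedImmersion) _ inferInstance
  refine exists_comp_eq_of_le_ker _ _ ?_
  rw [ker_ptEquiv_isoSpecOver_inv_comp_eq, ptEquiv_quotIncl]
  intro a ha
  have ha' : a ∈ J := by
    rw [← ker_comap_pullback_map_quotIncl_sat_eq K G J hJ]; exact ha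
  rw [RingHom.mem_ker, AlgHom.toRingHom_eq_coe, AlgHom.coe_toRingHom, Ideal.Quotient.mkₐ_eq_mk, Ideal.Quotient.eq_zero_iff_mem]
  exact ha'

/-- **`𝒦_κ` FACTORS THROUGH `V(spI J) ↪ 𝒢_κ`** (points criterion ★ `exists_comp_quotIncl_eq_of_affine` for the affine `𝒦_κ`: the ideal of `𝒦_κ ↪ 𝒢_κ` is `spI J` on
the nose, ★ `ker_comap_pullback_map_quotIncl_sat_eq_spI`). [cite: EGAIV2, Prop. 2.8.5] [cite: Tate1997FiniteFlatGroupSchemes, (3.7)]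
[cite: GortzWedhorn2023, (27.1.1) and §(27.2) (p. 607)] -/
theorem exists_comp_quotIncl_spI_eq_pullback_map_quotIncl_sat [IsFractionRing R K] [IsBezout R] [IsDomain R] (hJ : J.IsHopfIdeal K) :
    ∃ m : (Over.pullback (Spec.map (CommRingCat.ofHom (algebraMap R κ)))).obj
          (Motives.specOver R (Alg G ⧸ (J.map (algBaseChangeEquiv K G)).comap (includeRight : Alg G →ₐ[R] K ⊗[R] Alg G))) ⟶
        Motives.specOver κ (Alg ((Over.pullback (Spec.map (CommRingCat.ofHom (algebraMap R κ)))).obj G) ⧸ spI K κ G J),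
      m ≫ quotIncl _ (spI K κ G J) = (Over.pullback (Spec.map (CommRingCat.ofHom (algebraMap R κ)))).map
        (quotIncl G ((J.map (algBaseChangeEquiv K G)).comap (includeRight : Alg G →ₐ[R] K ⊗[R] Alg G))) := by
  haveI : IsAffine (Motives.specOver R (Alg G ⧸ (J.map (algBaseChangeEquiv K G)).comap (includeRight : Alg G →ₐ[R] K ⊗[R] Alg G))).left :=
    inferInstanceAs (IsAffine (Spec _))
  haveI : IsAffine ((Over.pullback (Spec.map (CommRingCat.ofHom (algebraMap R κ)))).obj
      (Motives.specOver R (Alg G ⧸ (J.map (algBaseChangeEquiv K G)).comap (includeRight : Alg G →ₐ[R] K ⊗[R] Alg G)))).left :=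
    inferInstanceAs (IsAffine (pullback _ _))
  refine exists_comp_quotIncl_eq_of_affine _ (spI K κ G J) _ ?_
  rw [ker_ptEquiv_isoSpecOver_inv_comp_eq]
  exact le_of_eq (ker_comap_pullback_map_quotIncl_sat_eq_spI K κ G J hJ).symm

/-! ## §2 IMAGE HEADS: a factorisation of `quotIncl J ≫ f` through `quotIncl J″ ≫ f″` transfers to the closures `𝒦`, `𝒵`, and out of them to `V(spI J)`,
`V(spI J″)` -/

variable (G'' : SchemeOver R) [GrpObj G''] [IsAffine G''.left]
  [IsAffine ((Over.pullback (Spec.map (CommRingCat.ofHom (algebraMap R K)))).obj G'').left]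
  [IsAffine ((Over.pullback (Spec.map (CommRingCat.ofHom (algebraMap R κ)))).obj G'').left]
  (J'' : Ideal (Alg ((Over.pullback (Spec.map (CommRingCat.ofHom (algebraMap R K)))).obj G'')))

omit [IsAffine ((Over.pullback (Spec.map (CommRingCat.ofHom (algebraMap R κ)))).obj G).left]
  [IsAffine ((Over.pullback (Spec.map (CommRingCat.ofHom (algebraMap R κ)))).obj G'').left] in
/-- **(IMG-in) A FACTORISATION THROUGH `V(J″) ↪ 𝒢″_K` UPSTAIRS TRANSFERS TO THE CLOSURES.**  For Hopf ideals `J ⊂ Γ(𝒢_K)`, `J″ ⊂ Γ(𝒢″_K)` with closures `𝒦 = V(J^sat) ↪ 𝒢`,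
`𝒵 = V(J″^sat) ↪ 𝒢″`, and ANY morphisms `f : 𝒢_K → X`, `f″ : 𝒢″_K → X`: if `quotIncl J ≫ f` factors through `quotIncl J″ ≫ f″`, then `(𝒦_K ↪ 𝒢_K) ≫ f` factors
through `(𝒵_K ↪ 𝒢″_K) ≫ f″` (compose `𝒦_K → V(J)` (★ §3) with the given arrow and `V(J″) → 𝒵_K` (§1)) — the conversion INTO the generic image hypothesis of ★
`RoofLegsSpecialFibreKernelRowsImage` (IMG-gen). [cite: EGAIV2, Prop. 2.8.5] [cite: Waterhouse1979, §2.1 (p. 14)] -/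
theorem exists_comp_pullback_map_quotIncl_sat_of_comp_quotIncl [IsFractionRing R K] [IsBezout R] [IsDomain R]
    (hJ : J.IsHopfIdeal K) (hJ'' : J''.IsHopfIdeal K) {X : SchemeOver K}
    (f : (Over.pullback (Spec.map (CommRingCat.ofHom (algebraMap R K)))).obj G ⟶ X)
    (f'' : (Over.pullback (Spec.map (CommRingCat.ofHom (algebraMap R K)))).obj G'' ⟶ X)
    (h : ∃ m₀ : Motives.specOver K (Alg ((Over.pullback (Spec.map (CommRingCat.ofHom (algebraMap R K)))).obj G) ⧸ J) ⟶
        Motives.specOver K (Alg ((Over.pullback (Spec.map (CommRingCat.ofHom (algebraMap R K)))).obj G'') ⧸ J''),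
      m₀ ≫ quotIncl _ J'' ≫ f'' = quotIncl _ J ≫ f) :
    ∃ m : (Over.pullback (Spec.map (CommRingCat.ofHom (algebraMap R K)))).obj
          (Motives.specOver R (Alg G ⧸ (J.map (algBaseChangeEquiv K G)).comap (includeRight : Alg G →ₐ[R] K ⊗[R] Alg G))) ⟶
        (Over.pullback (Spec.map (CommRingCat.ofHom (algebraMap R K)))).obj
          (Motives.specOver R (Alg G'' ⧸ (J''.map (algBaseChangeEquiv K G'')).comap (includeRight : Alg G'' →ₐ[R] K ⊗[R] Alg G''))),
      m ≫ (Over.pullback (Spec.map (CommRingCat.ofHom (algebraMap R K)))).map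
          (quotIncl G'' ((J''.map (algBaseChangeEquiv K G'')).comap (includeRight : Alg G'' →ₐ[R] K ⊗[R] Alg G''))) ≫ f'' =
        (Over.pullback (Spec.map (CommRingCat.ofHom (algebraMap R K)))).map
          (quotIncl G ((J.map (algBaseChangeEquiv K G)).comap (includeRight : Alg G →ₐ[R] K ⊗[R] Alg G))) ≫ f := by
  obtain ⟨m₀, hm₀⟩ := h
  obtain ⟨a, ha⟩ := exists_comp_quotIncl_eq_pullback_map_quotIncl_sat K G J hJ
  obtain ⟨b, hb⟩ := exists_comp_pullback_map_quotIncl_sat_eq_quotIncl K G'' J'' hJ''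
  refine ⟨a ≫ m₀ ≫ b, ?_⟩
  rw [Category.assoc, Category.assoc, reassoc_of% hb, hm₀, ← Category.assoc, ha]

/-- **(IMG-out) A FACTORISATION THROUGH THE CLOSURES DOWNSTAIRS TRANSFERS TO `V(spI J) → V(spI J″)`.**  For Hopf ideals `J ⊂ Γ(𝒢_K)`, `J″ ⊂ Γ(𝒢″_K)` with closures
`𝒦`, `𝒵`, and ANY morphisms `f̄ : 𝒢_κ → X̄`, `f̄″ : 𝒢″_κ → X̄`: if `(𝒦_κ ↪ 𝒢_κ) ≫ f̄` factors through `(𝒵_κ ↪ 𝒢″_κ) ≫ f̄″`, then `quotIncl (spI J) ≫ f̄` factors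
through `quotIncl (spI J″) ≫ f̄″` (compose `V(spI J) → 𝒦_κ` (★ §3) with the given arrow and `𝒵_κ → V(spI J″)` (§1)) — the conversion OUT OF the special image
conclusion of (IMG-gen), into the currency of the L2 leaflet's `spGeoOf := spI …` and its `himg` row. [cite: EGAIV2, Prop. 2.8.5] [cite: Tate1997FiniteFlatGroupSchemes, (3.7)] -/
theorem exists_comp_quotIncl_spI_of_comp_pullback_map [IsFractionRing R K] [IsBezout R] [IsDomain R]
    (hJ : J.IsHopfIdeal K) (hJ'' : J''.IsHopfIdeal K) {X : SchemeOver κ}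
    (f : (Over.pullback (Spec.map (CommRingCat.ofHom (algebraMap R κ)))).obj G ⟶ X)
    (f'' : (Over.pullback (Spec.map (CommRingCat.ofHom (algebraMap R κ)))).obj G'' ⟶ X)
    (h : ∃ m : (Over.pullback (Spec.map (CommRingCat.ofHom (algebraMap R κ)))).obj
          (Motives.specOver R (Alg G ⧸ (J.map (algBaseChangeEquiv K G)).comap (includeRight : Alg G →ₐ[R] K ⊗[R] Alg G))) ⟶
        (Over.pullback (Spec.map (CommRingCat.ofHom (algebraMap R κ)))).obj
          (Motives.specOver R (Alg G'' ⧸ (J''.map (algBaseChangeEquiv K G'')).comap (includeRight : Alg G'' →ₐ[R] K ⊗[R] Alg G''))),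
      m ≫ (Over.pullback (Spec.map (CommRingCat.ofHom (algebraMap R κ)))).map
          (quotIncl G'' ((J''.map (algBaseChangeEquiv K G'')).comap (includeRight : Alg G'' →ₐ[R] K ⊗[R] Alg G''))) ≫ f'' =
        (Over.pullback (Spec.map (CommRingCat.ofHom (algebraMap R κ)))).map
          (quotIncl G ((J.map (algBaseChangeEquiv K G)).comap (includeRight : Alg G →ₐ[R] K ⊗[R] Alg G))) ≫ f) :
    ∃ s : Motives.specOver κ (Alg ((Over.pullback (Spec.map (CommRingCat.ofHom (algebraMap R κ)))).obj G) ⧸ spI K κ G J) ⟶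
        Motives.specOver κ (Alg ((Over.pullback (Spec.map (CommRingCat.ofHom (algebraMap R κ)))).obj G'') ⧸ spI K κ G'' J''),
      s ≫ quotIncl _ (spI K κ G'' J'') ≫ f'' = quotIncl _ (spI K κ G J) ≫ f := by
  obtain ⟨m, hm⟩ := h
  obtain ⟨a, ha⟩ := exists_comp_pullback_map_quotIncl_sat_eq_quotIncl_spI K κ G J hJ
  obtain ⟨b, hb⟩ := exists_comp_quotIncl_spI_eq_pullback_map_quotIncl_sat K κ G'' J'' hJ''
  refine ⟨a ≫ m ≫ b, ?_⟩
  rw [Category.assoc, Category.assoc, reassoc_of% hb, hm, ← Category.assoc, ha]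

end AffineGroupScheme

end Literature.AlgebraicGeometry.GroupSchemes

end
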